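import Summits.KontsevichZagierPeriods.KontsevichZagierPeriods.Theorems.SymplecticScissorsRealOnePeriodRelationsLoopLayer

/-!
# Crux `RealOnePeriodRelations` (stmt-KontsevichZagierPeriods-10042) — THE LEGENDRE LAYER, UNCONDITIONALLY
# (`K(k)`, `E(k)` and all `∫₀¹ P(x²) dx/√((1−x²)(1−k²x²))` at algebraic moduli)

Line `nash-retraction-thin-strip`, gen-1 lead, continuation c3 (reshape 5), a corollary of the loop layer
(`realOnePeriodRelations_loopLayer_family`).  The complete elliptic integrals of the first and second kind in LEGENDRE form,
`K(k) = ∫₀¹ dx/√((1−x²)(1−k²x²))`, `E(k) = ∫₀¹ (1 − k²x²) dx/√((1−x²)(1−k²x²))`, and more generally the Legendre cells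
`[∫_{(0,1)} P(x²) dx/√((1−x²)(1−k²x²))]` (`P ∈ (ℚ̄ ∩ ℝ)[X]`, `0 < k < 1` algebraic), are odd oval cells of the depressed
Weierstrass cubic `u³ + Au + B` with roots `−s < 1 − s < 1/k² − s` (`s = (1 + 1/k²)/3`, `A = 1/k² − 3s²`, `B = s/k² − 2s³`)
modulo two rule-2 moves (`t = x²`, `u = t − s`; `legendre_cell`, `legendre_identity`).  Hence
`realOnePeriodRelations_legendreLayer`: for finitely many algebraic moduli (with the lattices of the associated cubics; complex
multiplication — singular moduli — allowed) every `ℤ`-combination with vanishing value of polynomial cells and Legendre cells lies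
in `M₁ = closure (1a ∪ 1b ∪ 2 ∪ Green)`; e.g. the singular-modulus relation `K(k′) = √3·K(k)`, `k = sin(π/12)`, and the
linear relations produced by Landen/Gauss transformations are generated by the four one-dimensional moves.
[cite: HuberWustholz2022, Thm 13.3 (2), Thm 15.3 (1),(3)] [cite: KontsevichZagier2001, §1.1–§1.2]
-/

noncomputable section

open scoped BigOperators Polynomial
open Set MeasureTheory MvPolynomial
open Literature.NumberTheory.Transcendental Literature.NumberTheory.Transcendental.CurvePeriods
open Summit.KontsevichZagierPeriods.SymplecticScissors.RealOnePeriodRelationsNegative (M₁ H₁ crux_iff unitDom)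

namespace Summit.KontsevichZagierPeriods.SymplecticScissors.RealOnePeriodRelations

namespace LoopLayer

/-- The Legendre-to-Weierstrass identity: with `s = (1 + 1/k²)/3`, `A = 1/k² − 3s²`, `B = s/k² − 2s³`,
`(u + s)(1 − (u + s))(1 − k²(u + s)) = k² (u³ + A u + B)`. [folklore] -/
theorem legendre_identity (k u : ℝ) (hk : k ≠ 0) :
    (u + (1 + 1 / k ^ 2) / 3) * (1 - (u + (1 + 1 / k ^ 2) / 3)) * (1 - k ^ 2 * (u + (1 + 1 / k ^ 2) / 3)) =
      k ^ 2 * (u ^ 3 + (1 / k ^ 2 - 3 * ((1 + 1 / k ^ 2) / 3) ^ 2) * u +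
        (((1 + 1 / k ^ 2) / 3) / k ^ 2 - 2 * ((1 + 1 / k ^ 2) / 3) ^ 3)) := by
  field_simp
  ring

/-- **A Legendre cell is an odd oval cell** (rules 2, 2): for an algebraic modulus `0 < k < 1` and `P ∈ (ℚ̄ ∩ ℝ)[X]`,
`[∫_{(0,1)} P(x²) dx/√((1 − x²)(1 − k²x²))]` — e.g. `K(k)` (`P = 1`), `E(k)` (`P = 1 − k²X`) — is, modulo `M₁`, the odd
oval cell `[∫_{(−s, 1−s)} P(u + s)/(2k) · du/√(u³ + Au + B)]` of the depressed Weierstrass cubic with roots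
`−s < 1 − s < 1/k² − s` (`s = (1 + 1/k²)/3`): substitute `t = x²` on `(0,1)` and translate `u = t − s`.
[cite: KontsevichZagier2001, §1.2 rule (2)] [cite: HuberWustholz2022, §13.2] -/
theorem legendre_cell (k : ℝ) (hk : IsAlgebraic ℚ k) (hk0 : 0 < k) (hk1 : k < 1) (P : Polynomial (algebraicClosure ℚ ℝ))
    (r : KZ.IntegralRep 1) (hdom : r.domain = {z | z 0 ∈ Set.Ioo (0 : ℝ) 1})
    (hint : ∀ x ∈ Set.Ioo (0 : ℝ) 1, r.integrand (fun _ => x) =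
      Polynomial.aeval (x ^ 2) P / Real.sqrt ((1 - x ^ 2) * (1 - k ^ 2 * x ^ 2))) :
    ∃ ρ : KZ.IntegralRep 1,
      (∃ e₁ e₂ : ℝ, IsAlgebraic ℚ e₁ ∧ IsAlgebraic ℚ e₂ ∧ e₁ < e₂ ∧
          e₁ ^ 3 + (1 / k ^ 2 - 3 * ((1 + 1 / k ^ 2) / 3) ^ 2) * e₁ +
            (((1 + 1 / k ^ 2) / 3) / k ^ 2 - 2 * ((1 + 1 / k ^ 2) / 3) ^ 3) = 0 ∧
          e₂ ^ 3 + (1 / k ^ 2 - 3 * ((1 + 1 / k ^ 2) / 3) ^ 2) * e₂ +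
            (((1 + 1 / k ^ 2) / 3) / k ^ 2 - 2 * ((1 + 1 / k ^ 2) / 3) ^ 3) = 0 ∧
          (∀ x ∈ Set.Ioo e₁ e₂, 0 < x ^ 3 + (1 / k ^ 2 - 3 * ((1 + 1 / k ^ 2) / 3) ^ 2) * x +
            (((1 + 1 / k ^ 2) / 3) / k ^ 2 - 2 * ((1 + 1 / k ^ 2) / 3) ^ 3)) ∧
          ρ.domain = {z | z 0 ∈ Set.Ioo e₁ e₂} ∧
          ∃ P₁ P₂ P₃ : Polynomial (algebraicClosure ℚ ℝ), ∀ x ∈ Set.Ioo e₁ e₂,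
            ρ.integrand (fun _ => x) = Polynomial.aeval x P₁ +
              Polynomial.aeval x P₂ * Real.sqrt (x ^ 3 + (1 / k ^ 2 - 3 * ((1 + 1 / k ^ 2) / 3) ^ 2) * x +
                (((1 + 1 / k ^ 2) / 3) / k ^ 2 - 2 * ((1 + 1 / k ^ 2) / 3) ^ 3)) +
              Polynomial.aeval x P₃ / Real.sqrt (x ^ 3 + (1 / k ^ 2 - 3 * ((1 + 1 / k ^ 2) / 3) ^ 2) * x +
                (((1 + 1 / k ^ 2) / 3) / k ^ 2 - 2 * ((1 + 1 / k ^ 2) / 3) ^ 3))) ∧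
      KZ.of r - KZ.of ρ ∈ M₁ := by
  -- abbreviations
  set s : ℝ := (1 + 1 / k ^ 2) / 3 with hs
  set A : ℝ := 1 / k ^ 2 - 3 * s ^ 2 with hA
  set B : ℝ := s / k ^ 2 - 2 * s ^ 3 with hB
  have hk0' : k ≠ 0 := hk0.ne'
  have hsalg' : IsAlgebraic ℚ s := by
    have h1 : IsAlgebraic ℚ (1 + 1 / k ^ 2) := isAlgebraic_one.add (by rw [one_div]; exact (hk.pow 2).inv)
    have h2 : IsAlgebraic ℚ ((1 + 1 / k ^ 2) / 3) := by rw [div_eq_mul_inv]; exact h1.mul (isAlgebraic_nat 3).inv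
    exact h2
  have hident : ∀ u : ℝ, (u + s) * (1 - (u + s)) * (1 - k ^ 2 * (u + s)) = k ^ 2 * (u ^ 3 + A * u + B) := by
    intro u
    have h := legendre_identity k u hk0'
    simp only [hs, hA, hB]
    exact h
  have hmemr : ∀ p : Fin 1 → ℝ, p ∈ r.domain ↔ p 0 ∈ Set.Ioo (0 : ℝ) 1 := fun p => by rw [hdom]; rfl
  -- chart 1: `t = x²` on `(0,1)`
  have hσ := r.isSemialgebraic_domain
  have h0 : IsSemialgebraicFunOn ℚ r.domain (fun p : Fin 1 → ℝ => p 0) := isSemialgebraicFunOn_apply hσ 0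
  have hφ₁ : IsSemialgebraicFunOn ℚ r.domain (fun p => (fun x : ℝ => x ^ 2) (p 0)) := h0.fun_pow 2
  have hφ₁' : IsSemialgebraicFunOn ℚ r.domain (fun p => (fun x : ℝ => 2 * x) (p 0)) :=
    (isSemialgebraicFunOn_const_ofNat hσ 2).fun_mul h0
  have hder₁ : ∀ p ∈ r.domain, HasDerivAt (fun x : ℝ => x ^ 2) (2 * p 0) (p 0) := fun p _ => by
    simpa using hasDerivAt_pow 2 (p 0)
  have hne₁ : ∀ p ∈ r.domain, 2 * p 0 ≠ 0 := fun p hp =>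
    mul_ne_zero two_ne_zero ((hmemr p).1 hp).1.ne'
  have hinj₁ : Set.InjOn (fun p : Fin 1 → ℝ => fun _ : Fin 1 => (fun x : ℝ => x ^ 2) (p 0)) r.domain := by
    intro p hp p' hp' h
    have h' : p 0 ^ 2 = p' 0 ^ 2 := congrFun h 0
    have hx := ((hmemr p).1 hp).1.le
    have hy := ((hmemr p').1 hp').1.le
    have : p 0 = p' 0 := by
      have := congrArg Real.sqrt h'
      rwa [Real.sqrt_sq hx, Real.sqrt_sq hy] at this
    rw [KZ.eq_const_apply_zero p, KZ.eq_const_apply_zero p', this]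
  obtain ⟨s₁, hs₁dom, hs₁i, hrel₁⟩ := helper_cells_1 r (fun x : ℝ => x ^ 2) (fun x : ℝ => 2 * x) hφ₁ hφ₁' hder₁ hne₁ hinj₁
  have hs₁dom' : s₁.domain = {z | z 0 ∈ Set.Ioo (0 : ℝ) 1} := by
    rw [hs₁dom]
    ext z
    constructor
    · rintro ⟨p, hp, rfl⟩
      have hp' := (hmemr p).1 hp
      exact ⟨by simpa using pow_pos hp'.1 2, by
        have : p 0 ^ 2 < 1 := by nlinarith [hp'.1, hp'.2]
        simpa using this⟩
    · intro hz
      refine ⟨fun _ => Real.sqrt (z 0), (hmemr _).2 ⟨Real.sqrt_pos.2 hz.1, ?_⟩, ?_⟩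
      · rw [Real.sqrt_lt' one_pos]; simpa using hz.2
      · rw [KZ.eq_const_apply_zero z]
        funext
        simp [Real.sq_sqrt hz.1.le]
  have hmems₁ : ∀ p : Fin 1 → ℝ, p ∈ s₁.domain ↔ p 0 ∈ Set.Ioo (0 : ℝ) 1 := fun p => by rw [hs₁dom']; rfl
  have hs₁int : ∀ t ∈ Set.Ioo (0 : ℝ) 1, s₁.integrand (fun _ => t) =
      Polynomial.aeval t P / (2 * Real.sqrt (t * ((1 - t) * (1 - k ^ 2 * t)))) := by
    intro t ht
    set x : ℝ := Real.sqrt t with hx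
    have hx0 : 0 < x := Real.sqrt_pos.2 ht.1
    have hx2 : x ^ 2 = t := Real.sq_sqrt ht.1.le
    have hxmem : x ∈ Set.Ioo (0 : ℝ) 1 := ⟨hx0, by rw [hx, Real.sqrt_lt' one_pos]; simpa using ht.2⟩
    have h := hs₁i (fun _ => x) ((hmemr _).2 hxmem)
    rw [hx2] at h
    rw [h, hint x hxmem, abs_of_pos (mul_pos two_pos hx0), hx2, Real.sqrt_mul ht.1.le, ← hx, div_div]
    ring_nf
  -- chart 2: `u = t − s`
  have hσ₁ := s₁.isSemialgebraic_domain
  have h0' : IsSemialgebraicFunOn ℚ s₁.domain (fun p : Fin 1 → ℝ => p 0) := isSemialgebraicFunOn_apply hσ₁ 0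
  have hφ₂ : IsSemialgebraicFunOn ℚ s₁.domain (fun p => (fun t : ℝ => t - s) (p 0)) :=
    h0'.fun_sub (isSemialgebraicFunOn_const_of_isAlgebraic hσ₁ hsalg')
  have hφ₂' : IsSemialgebraicFunOn ℚ s₁.domain (fun p => (fun _ : ℝ => (1 : ℝ)) (p 0)) :=
    isSemialgebraicFunOn_const_of_isAlgebraic hσ₁ isAlgebraic_one
  have hder₂ : ∀ p ∈ s₁.domain, HasDerivAt (fun t : ℝ => t - s) ((fun _ : ℝ => (1 : ℝ)) (p 0)) (p 0) :=
    fun p _ => (hasDerivAt_id (p 0)).sub_const s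
  have hne₂ : ∀ p ∈ s₁.domain, (fun _ : ℝ => (1 : ℝ)) (p 0) ≠ 0 := fun _ _ => one_ne_zero
  have hinj₂ : Set.InjOn (fun p : Fin 1 → ℝ => fun _ : Fin 1 => (fun t : ℝ => t - s) (p 0)) s₁.domain := by
    intro p _ p' _ h
    have h' : p 0 - s = p' 0 - s := congrFun h 0
    rw [KZ.eq_const_apply_zero p, KZ.eq_const_apply_zero p', sub_left_injective h']
  obtain ⟨s₂, hs₂dom, hs₂i, hrel₂⟩ := helper_cells_1 s₁ (fun t : ℝ => t - s) (fun _ : ℝ => (1 : ℝ)) hφ₂ hφ₂' hder₂ hne₂ hinj₂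
  have hs₂dom' : s₂.domain = {z | z 0 ∈ Set.Ioo (0 - s) (1 - s)} := by
    rw [hs₂dom]
    ext z
    constructor
    · rintro ⟨p, hp, rfl⟩
      have hp' := (hmems₁ p).1 hp
      exact ⟨by simpa using hp'.1, by simpa using hp'.2⟩
    · intro hz
      refine ⟨fun _ => z 0 + s, (hmems₁ _).2 ⟨by linarith [hz.1], by linarith [hz.2]⟩, ?_⟩
      rw [KZ.eq_const_apply_zero z]
      funext
      simp
  -- the odd oval cell
  have hpos3 : ∀ x ∈ Set.Ioo (0 - s) (1 - s), 0 < x ^ 3 + A * x + B := by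
    intro x hx
    have h1 : 0 < x + s := by linarith [hx.1]
    have h2 : 0 < 1 - (x + s) := by linarith [hx.2]
    have h3 : 0 < 1 - k ^ 2 * (x + s) := by
      have hk2 : k ^ 2 < 1 := by nlinarith
      have : k ^ 2 * (x + s) < 1 := by
        calc k ^ 2 * (x + s) ≤ k ^ 2 * 1 := by nlinarith [sq_nonneg k, hx.2]
          _ < 1 := by linarith
      linarith
    have hprod : 0 < (x + s) * (1 - (x + s)) * (1 - k ^ 2 * (x + s)) := mul_pos (mul_pos h1 h2) h3
    rw [hident x] at hprod
    exact (mul_pos_iff_of_pos_left (pow_pos hk0 2)).1 hprod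
  have hroot1 : (0 - s) ^ 3 + A * (0 - s) + B = 0 := by
    have h : k ^ 2 * ((0 - s) ^ 3 + A * (0 - s) + B) = 0 := by rw [← hident (0 - s)]; ring
    exact (mul_eq_zero.1 h).resolve_left (pow_ne_zero 2 hk0')
  have hroot2 : (1 - s) ^ 3 + A * (1 - s) + B = 0 := by
    have h : k ^ 2 * ((1 - s) ^ 3 + A * (1 - s) + B) = 0 := by rw [← hident (1 - s)]; ring
    exact (mul_eq_zero.1 h).resolve_left (pow_ne_zero 2 hk0')
  have hmemK : (1 / (2 * k) : ℝ) ∈ algebraicClosure ℚ ℝ :=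
    mem_algebraicClosure_iff.2 (by rw [one_div]; exact ((isAlgebraic_nat 2).mul hk).inv)
  have hmemS : s ∈ algebraicClosure ℚ ℝ := mem_algebraicClosure_iff.2 hsalg'
  refine ⟨s₂, ⟨0 - s, 1 - s, isAlgebraic_zero.sub hsalg', isAlgebraic_one.sub hsalg', by linarith, hroot1, hroot2, hpos3,
    hs₂dom', 0, 0, Polynomial.C (⟨1 / (2 * k), hmemK⟩ : algebraicClosure ℚ ℝ) *
      P.comp (Polynomial.X + Polynomial.C (⟨s, hmemS⟩ : algebraicClosure ℚ ℝ)), fun u hu => ?_⟩, ?_⟩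
  · -- the integrand on `(−s, 1−s)`
    have ht : u + s ∈ Set.Ioo (0 : ℝ) 1 := ⟨by linarith [hu.1], by linarith [hu.2]⟩
    have h := hs₂i (fun _ => u + s) ((hmems₁ _).2 ht)
    simp only [add_sub_cancel_right, abs_one, div_one] at h
    rw [h, hs₁int _ ht, map_zero, zero_add, zero_mul, zero_add]
    have hf : 0 < u ^ 3 + A * u + B := hpos3 u hu
    have hsq : Real.sqrt ((u + s) * ((1 - (u + s)) * (1 - k ^ 2 * (u + s)))) = k * Real.sqrt (u ^ 3 + A * u + B) := by
      rw [← mul_assoc, hident u, Real.sqrt_mul (sq_nonneg k), Real.sqrt_sq hk0.le]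
    rw [hsq]
    simp only [map_mul, Polynomial.aeval_C, Polynomial.aeval_comp, map_add, Polynomial.aeval_X,
      IntermediateField.algebraMap_apply]
    have hsqrt0 : Real.sqrt (u ^ 3 + A * u + B) ≠ 0 := (Real.sqrt_pos.2 hf).ne'
    field_simp
  · have e : KZ.of r - KZ.of s₂ = (KZ.of r - KZ.of s₁) + (KZ.of s₁ - KZ.of s₂) := by abel
    rw [e]
    exact M₁.add_mem hrel₁ hrel₂

/-- **THE LEGENDRE LAYER: `K(k)`, `E(k)` AND ALL `∫₀¹ P(x²) dx/√((1−x²)(1−k²x²))` AT ALGEBRAIC MODULI, UNCONDITIONALLY.**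
For finitely many algebraic moduli `0 < k_j < 1` (with the lattices of the associated depressed Weierstrass cubics, complex
multiplication allowed — singular moduli included), every `ℤ`-combination with vanishing value of polynomial cells and Legendre
cells `[∫_{(0,1)} P(x²) dx/√((1 − x²)(1 − k_j²x²))]` (`P ∈ (ℚ̄ ∩ ℝ)[X]`; `K(k_j)`, `E(k_j)` and their algebraic multiples are the
cases `P = c`, `P = c(1 − k_j²X)`) lies in `M₁ = closure (1a ∪ 1b ∪ 2 ∪ Green)`: e.g. the singular-modulus relation
`K(k′) = √3 K(k)` for `k = sin(π/12)`, and every linear relation between complete integrals at moduli related by a modular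
(Landen/Gauss) transformation, is generated by the four one-dimensional moves.  Proof: `legendre_cell` (two rule-2 moves) and
`realOnePeriodRelations_loopLayer_family`. [cite: HuberWustholz2022, Thm 13.3 (2), Thm 15.3] [cite: KontsevichZagier2001, §1.2] -/
theorem realOnePeriodRelations_legendreLayer : ∀ (n : ℕ) (k : Fin n → ℝ), (∀ j, IsAlgebraic ℚ (k j)) → (∀ j, 0 < k j) →
    (∀ j, k j < 1) → ∀ (L : Fin n → PeriodPair),
    (∀ j, (L j).g₂ = -4 * ((1 / k j ^ 2 - 3 * ((1 + 1 / k j ^ 2) / 3) ^ 2 : ℝ) : ℂ)) →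
    (∀ j, (L j).g₃ = -4 * ((((1 + 1 / k j ^ 2) / 3) / k j ^ 2 - 2 * ((1 + 1 / k j ^ 2) / 3) ^ 3 : ℝ) : ℂ)) →
    ∀ c : KZ.FormalRep, c ∈ AddSubgroup.closure ((fun r : KZ.IntegralRep 1 => KZ.of r) ''
      {r | (∃ a b : ℝ, IsAlgebraic ℚ a ∧ IsAlgebraic ℚ b ∧ a < b ∧ r.domain = {z | z 0 ∈ Set.Ioo a b} ∧
            ∃ P : Polynomial (algebraicClosure ℚ ℝ), ∀ x ∈ Set.Ioo a b, r.integrand (fun _ => x) = Polynomial.aeval x P) ∨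
        (∃ j, r.domain = {z | z 0 ∈ Set.Ioo (0 : ℝ) 1} ∧ ∃ P : Polynomial (algebraicClosure ℚ ℝ), ∀ x ∈ Set.Ioo (0 : ℝ) 1,
          r.integrand (fun _ => x) = Polynomial.aeval (x ^ 2) P / Real.sqrt ((1 - x ^ 2) * (1 - k j ^ 2 * x ^ 2)))}) →
    KZ.eval c = 0 →
    c ∈ AddSubgroup.closure (KZ.domainAddRel ∪ KZ.integrandAddRel ∪ KZ.changeOfVariablesRel ∪
      {g : KZ.FormalRep | ∃ (Δ : Set (Fin 2 → ℝ)) (A B S : (Fin 2 → ℝ) → ℝ) (r₀₁ r₁₂ r₀₂ : KZ.IntegralRep 1),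
        Δ = {p | 0 ≤ p 0 ∧ 0 ≤ p 1 ∧ p 0 + p 1 ≤ 1} ∧ IsSemialgebraicFunOn ℚ Δ A ∧ IsSemialgebraicFunOn ℚ Δ B ∧
        ContinuousOn A Δ ∧ ContinuousOn B Δ ∧
        (∀ p : Fin 2 → ℝ, 0 < p 0 → 0 < p 1 → p 0 + p 1 < 1 →
          HasFDerivAt S (A p • ContinuousLinearMap.proj (R := ℝ) (φ := fun _ : Fin 2 => ℝ) 0 +
            B p • ContinuousLinearMap.proj (R := ℝ) (φ := fun _ : Fin 2 => ℝ) 1) p) ∧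
        r₀₁.domain = {z | z 0 ∈ Set.Ioo 0 1} ∧ r₁₂.domain = {z | z 0 ∈ Set.Ioo 0 1} ∧
        r₀₂.domain = {z | z 0 ∈ Set.Ioo 0 1} ∧ (∀ z ∈ r₀₁.domain, r₀₁.integrand z = A ![z 0, 0]) ∧
        (∀ z ∈ r₁₂.domain, r₁₂.integrand z = B ![1 - z 0, z 0] - A ![1 - z 0, z 0]) ∧
        (∀ z ∈ r₀₂.domain, r₀₂.integrand z = B ![0, z 0]) ∧ g = KZ.of r₀₁ + KZ.of r₁₂ - KZ.of r₀₂}) := by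
  intro n k hk hk0 hk1 L hL₂ hL₃ c hc heval
  change c ∈ M₁
  -- the associated Weierstrass data
  set A : Fin n → ℝ := fun j => 1 / k j ^ 2 - 3 * ((1 + 1 / k j ^ 2) / 3) ^ 2 with hA
  set B : Fin n → ℝ := fun j => ((1 + 1 / k j ^ 2) / 3) / k j ^ 2 - 2 * ((1 + 1 / k j ^ 2) / 3) ^ 3 with hB
  have hsalg : ∀ j, IsAlgebraic ℚ ((1 + 1 / k j ^ 2) / 3) := fun j => by
    have h1 : IsAlgebraic ℚ (1 + 1 / k j ^ 2) := isAlgebraic_one.add (by rw [one_div]; exact ((hk j).pow 2).inv)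
    rw [div_eq_mul_inv]; exact h1.mul (isAlgebraic_nat 3).inv
  have hAalg : ∀ j, IsAlgebraic ℚ (A j) := fun j => by
    simp only [hA]
    exact (by rw [one_div]; exact ((hk j).pow 2).inv : IsAlgebraic ℚ (1 / k j ^ 2)).sub
      ((isAlgebraic_nat 3).mul ((hsalg j).pow 2))
  have hBalg : ∀ j, IsAlgebraic ℚ (B j) := fun j => by
    simp only [hB]
    refine IsAlgebraic.sub ?_ ((isAlgebraic_nat 2).mul ((hsalg j).pow 3))
    rw [div_eq_mul_inv]
    exact (hsalg j).mul (by rw [← one_div, one_div]; exact ((hk j).pow 2).inv)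
  -- every `c` in the Legendre closure is congruent modulo `M₁` to a `c′` in the loop-layer closure
  have key : ∀ c : KZ.FormalRep, c ∈ AddSubgroup.closure ((fun r : KZ.IntegralRep 1 => KZ.of r) ''
      {r | (∃ a b : ℝ, IsAlgebraic ℚ a ∧ IsAlgebraic ℚ b ∧ a < b ∧ r.domain = {z | z 0 ∈ Set.Ioo a b} ∧
            ∃ P : Polynomial (algebraicClosure ℚ ℝ), ∀ x ∈ Set.Ioo a b, r.integrand (fun _ => x) = Polynomial.aeval x P) ∨
        (∃ j, r.domain = {z | z 0 ∈ Set.Ioo (0 : ℝ) 1} ∧ ∃ P : Polynomial (algebraicClosure ℚ ℝ), ∀ x ∈ Set.Ioo (0 : ℝ) 1,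
          r.integrand (fun _ => x) = Polynomial.aeval (x ^ 2) P / Real.sqrt ((1 - x ^ 2) * (1 - k j ^ 2 * x ^ 2)))}) →
      ∃ c' : KZ.FormalRep, c' ∈ AddSubgroup.closure ((fun r : KZ.IntegralRep 1 => KZ.of r) ''
      {r | (∃ a b : ℝ, IsAlgebraic ℚ a ∧ IsAlgebraic ℚ b ∧ a < b ∧ r.domain = {z | z 0 ∈ Set.Ioo a b} ∧
            ∃ P : Polynomial (algebraicClosure ℚ ℝ), ∀ x ∈ Set.Ioo a b, r.integrand (fun _ => x) = Polynomial.aeval x P) ∨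
        (∃ j, ∃ e₁ e₂ : ℝ, IsAlgebraic ℚ e₁ ∧ IsAlgebraic ℚ e₂ ∧ e₁ < e₂ ∧ e₁ ^ 3 + A j * e₁ + B j = 0 ∧
          e₂ ^ 3 + A j * e₂ + B j = 0 ∧ (∀ x ∈ Set.Ioo e₁ e₂, 0 < x ^ 3 + A j * x + B j) ∧
          r.domain = {z | z 0 ∈ Set.Ioo e₁ e₂} ∧
          ∃ P₁ P₂ P₃ : Polynomial (algebraicClosure ℚ ℝ), ∀ x ∈ Set.Ioo e₁ e₂,
            r.integrand (fun _ => x) = Polynomial.aeval x P₁ + Polynomial.aeval x P₂ * Real.sqrt (x ^ 3 + A j * x + B j) +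
              Polynomial.aeval x P₃ / Real.sqrt (x ^ 3 + A j * x + B j)) ∨
        (∃ j, ∃ e c₀ : ℝ, IsAlgebraic ℚ e ∧ IsAlgebraic ℚ c₀ ∧ e ^ 3 + A j * e + B j = 0 ∧
          (∀ x : ℝ, e < x → 0 < x ^ 3 + A j * x + B j) ∧ r.domain = {z | e < z 0} ∧
          ∀ z ∈ r.domain, r.integrand z = c₀ / Real.sqrt ((z 0) ^ 3 + A j * (z 0) + B j))}) ∧ c - c' ∈ M₁ := by
    intro c hc
    refine AddSubgroup.closure_induction (p := fun c _ => ∃ c' : KZ.FormalRep, c' ∈ _ ∧ c - c' ∈ M₁) ?_ ?_ ?_ ?_ hc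
    · rintro _ ⟨r, hr, rfl⟩
      rcases hr with hpoly | ⟨j, hdom, P, hint⟩
      · exact ⟨KZ.of r, AddSubgroup.subset_closure ⟨r, Or.inl hpoly, rfl⟩, by rw [sub_self]; exact M₁.zero_mem⟩
      · obtain ⟨ρ, hρ, hrel⟩ := legendre_cell (k j) (hk j) (hk0 j) (hk1 j) P r hdom hint
        exact ⟨KZ.of ρ, AddSubgroup.subset_closure ⟨ρ, Or.inr (Or.inl ⟨j, hρ⟩), rfl⟩, hrel⟩
    · exact ⟨0, AddSubgroup.zero_mem _, by rw [sub_self]; exact M₁.zero_mem⟩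
    · rintro c₁ c₂ _ _ ⟨c₁', h₁', h₁⟩ ⟨c₂', h₂', h₂⟩
      refine ⟨c₁' + c₂', AddSubgroup.add_mem _ h₁' h₂', ?_⟩
      have e : c₁ + c₂ - (c₁' + c₂') = (c₁ - c₁') + (c₂ - c₂') := by abel
      rw [e]
      exact M₁.add_mem h₁ h₂
    · rintro c₁ _ ⟨c₁', h₁', h₁⟩
      refine ⟨-c₁', AddSubgroup.neg_mem _ h₁', ?_⟩
      have e : -c₁ - -c₁' = -(c₁ - c₁') := by abel
      rw [e]
      exact M₁.neg_mem h₁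
  obtain ⟨c', hc', hcc'⟩ := key c hc
  have heval' : KZ.eval c' = 0 := by
    have h := Summit.KontsevichZagierPeriods.SymplecticScissors.RealOnePeriodRelationsNegative.eval_eq_zero_of_mem_M₁ hcc'
    rw [map_sub, heval, zero_sub, neg_eq_zero] at h
    exact h
  have hM : c' ∈ M₁ :=
    realOnePeriodRelations_loopLayer_family n A B hAalg hBalg L (fun j => by rw [hL₂ j]) (fun j => by rw [hL₃ j])
      c' hc' heval'
  have e : c = (c - c') + c' := by abel
  rw [e]
  exact M₁.add_mem hcc' hM

end LoopLayer

end Summit.KontsevichZagierPeriods.SymplecticScissors.RealOnePeriodRelations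

end
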